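/-
Copyright: b2b-lace packet (LEAN TYPING SEAT 1, gen 11).  [FvdH17] §4.2 (4.20)–(4.25): the UNCONDITIONAL
Bubble cell `Σ_x 𝒟_{n,n}(x) ≤ ½ · Bound[Bubble, 2n]` — the extraction bound of `DoubleConnectionBubble`
(literature seat) plugged into the Fourier side `DoubleConnectionBubbleFourier` — and the `N = 0`
consumers `Σ_x Ξ^{(0)}_p(x)`, `Σ_x Ξ^{R,(0)}_p(x)` of Lemma 4.2 (4.25) in `SumLE` form.
-/
import Literature.Probability.FitznerVanDerHofstad2017.DoubleConnectionBubble
import Literature.Probability.FitznerVanDerHofstad2017.DoubleConnectionBubbleFourier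
import HarnessLib

/-!
# [FvdH17] (4.20)–(4.25): the Bubble cell for `Σ_x 𝒟_{n,n}(x)` and the `N = 0` bounds, unconditionally

Reproduction module (build `lace`, LEAN-IN-TREE RULE) in the package of
R. Fitzner, R. van der Hofstad, *Mean-field behavior for nearest-neighbor percolation in `d > 10`*,
Electron. J. Probab. **22** (2017) no. 43 [FvdH17] (arXiv:1506.07977v2), §4.2 "Bounds on double connections"
and Lemma 4.2 (arXiv v2 pp. 36–37 = EJP p. 34):

> "Using (4.22), `x ≠ 0` and (4.21), we obtain … (4.25)"

This file only COMPOSES two kernel theorems of the package: the closed-trail extraction summed over a finite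
set, `two_mul_sum_diagD_le_extraction` ((4.20)–(4.21), module `DoubleConnectionBubble`), which DISCHARGES the
hypothesis `hE` of the Fourier-side cell `sumLE_diagD_bubble` ((4.21)–(4.23) with SRW-integral tails, module
`DoubleConnectionBubbleFourier`); and then the `N = 0` transfers `sumLE_nobleXiN_zero_of_diagD` ((4.22)) and
`FvdH17_L42_d423a` ((4.23), `Ξ^{R,(0)} ≤ 𝒟_{2,2}`).  Notation: `D = srwStep d`, `Γ̄₂ = nobleSup2 d p`,
`K_{j,m}(0) = srwK d j m 0`, `a_L(0) = #trailWordsTo d L 0`; `p < p_c(ℤ^d)`, `d ≥ 5`.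

* `extraction_bound`: the hypothesis `hE` of `DoubleConnectionBubbleFourier` holds (it is the literal
  conclusion of `two_mul_sum_diagD_le_extraction`, `idxTwoTail n M = trailWords d (M−n) ×ˢ trailWords d n`).
* `sumLE_diagD_halfBubble` (`1 ≤ n`, `2n ≤ M`):
  `Σ_x 𝒟_{n,n}(x) ≤ ½ ( Σ_{L=2n}^{M−1} (L+1−2n) a_L(0) p^L + (M−2n) (2dp)^M Γ̄₂ K_{1,M}(0) + (2dp)^M Γ̄₂² K_{2,M}(0) )`
  as `SumLE (diagD d p n n) (½ · …)`; `sumLE_diagD_halfBubble_of_le` (`p ≤ z`, `Γ̄₂ ≤ Γ₂'`: one half of the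
  notebook cell `Bound[Bubble, 2n, s]`), `sumLE_diagD_halfBubble_printed` (constants `Γ₁, Γ₂` via
  [NoBLE17] §5.3.1 and (5.13)).
* `sumLE_nobleXiN_zero_halfBubble` (`2 ≤ M`): `Σ_x Ξ^{(0)}_p(x) ≤ ½ · Bound[Bubble, 2]` (SRW-integral form);
  `sumLE_xiR_zero_halfBubble` (`4 ≤ M`): `Σ_x Ξ^{R,(0)}_p(x) ≤ ½ · Bound[Bubble, 4]`.

No numerals are evaluated; no cited hypothesis; all theorems kernel-checked modulo the standard axioms.

[cite: FitznerVanDerHofstad2017, §4.2 (4.20)–(4.25) and Lemma 4.2 (arXiv:1506.07977v2 pp. 36–37; EJP 22 (2017) no. 43 p. 34)]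
[cite: FitznerVanDerHofstad2016NoBLE, §5.3.2 first display (PTRF 169 (2017) p. 1097)]
-/

noncomputable section

namespace Literature.Probability.FitznerVanDerHofstad2017

open MeasureTheory Real Finset Filter
open scoped BigOperators
open Literature.Probability.LatticeModels
open Literature.Probability.Percolation
open Literature.Barriers.CriticalPhenomena

variable {d : ℕ}

/-- **The extraction bound [FvdH17] (4.20)–(4.21) summed over a finite `S`** in the shape of the hypothesis
`hE` of `DoubleConnectionBubbleFourier` (`idxTwoTail` unfolded): a restatement of
`two_mul_sum_diagD_le_extraction`. [cite: FitznerVanDerHofstad2017, §4.2 (4.20)–(4.21) (arXiv:1506.07977v2 pp. 36–37)] -/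
theorem extraction_bound (p : unitInterval) {n : ℕ} (hn : 1 ≤ n) (M : ℕ) :
    ∀ S : Finset (Site d), 2 * ∑ x ∈ S, diagD d p n n x ≤
      (∑ L ∈ Finset.Ico (2 * n) M,
          ((Finset.Icc n (L - n)).card : ℝ) * ((trailWordsTo d L 0).card : ℝ) * (p : ℝ) ^ L) +
        ((Finset.Ico n (M - n)).card : ℝ) * ((p : ℝ) ^ M * ∑ u ∈ trailWords d M, tau d p (wordPos u M) 0) +
          (p : ℝ) ^ (M - n) * (p : ℝ) ^ n *
            ∑ uu ∈ (trailWords d (M - n)) ×ˢ (trailWords d n),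
              ∑ x ∈ S, tau d p (wordPos uu.1 (M - n)) x * tau d p (wordPos uu.2 n) x :=
  fun S => two_mul_sum_diagD_le_extraction p hn M S

/-- **The Bubble cell, unconditionally** (`d ≥ 5`, `p < p_c`, `1 ≤ n`, `2n ≤ M`):
`Σ_x 𝒟_{n,n}(x) ≤ ½ ( Σ_{L=2n}^{M−1} (L+1−2n) a_L(0) p^L + (M−2n) (2dp)^M Γ̄₂ K_{1,M}(0) + (2dp)^M Γ̄₂² K_{2,M}(0) )`.
[cite: FitznerVanDerHofstad2017, §4.2 (4.20)–(4.23) (arXiv:1506.07977v2 pp. 36–37; EJP 22 (2017) no. 43 p. 34)]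
[cite: FitznerVanDerHofstad2016NoBLE, §5.3.2 first display (PTRF 169 (2017) p. 1097)] -/
theorem sumLE_diagD_halfBubble (hd : 5 ≤ d) (p : unitInterval) (hp : p < criticalProbI d) {n : ℕ}
    (hn : 1 ≤ n) {M : ℕ} (hM : 2 * n ≤ M) :
    SumLE (diagD d p n n)
      (1 / 2 * ((∑ L ∈ Finset.Ico (2 * n) M, ((L + 1 - 2 * n : ℕ) : ℝ) * ((trailWordsTo d L 0).card : ℝ) * (p : ℝ) ^ L) +
        ((M - 2 * n : ℕ) : ℝ) * ((2 * d * (p : ℝ)) ^ M * (nobleSup2 d p * srwK d 1 M 0)) +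
          (2 * d * (p : ℝ)) ^ M * (nobleSup2 d p ^ 2 * srwK d 2 M 0))) :=
  sumLE_diagD_bubble (extraction_bound p hn M) hd hp hn hM

/-- **The Bubble cell in the notebook's constants, unconditionally** (`p ≤ z`, `Γ̄₂ ≤ Γ₂'`): one half of
`Bound[Bubble, 2n, s]`. [cite: FitznerVanDerHofstad2017, §4.2 (4.20)–(4.23) (arXiv:1506.07977v2 pp. 36–37)]
[cite: FitznerVanDerHofstad2016NoBLE, §5.3.2 first display and "Numeric: Bubble" (PTRF 169 (2017) p. 1097)] -/
theorem sumLE_diagD_halfBubble_of_le (hd : 5 ≤ d) (p : unitInterval) (hp : p < criticalProbI d) {n : ℕ}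
    (hn : 1 ≤ n) {M : ℕ} (hM : 2 * n ≤ M) {z Γ₂' : ℝ} (hz : (p : ℝ) ≤ z) (hΓ : nobleSup2 d p ≤ Γ₂') :
    SumLE (diagD d p n n)
      (1 / 2 * ((∑ L ∈ Finset.Ico (2 * n) M, ((L + 1 - 2 * n : ℕ) : ℝ) * ((trailWordsTo d L 0).card : ℝ) * z ^ L) +
        ((M - 2 * n : ℕ) : ℝ) * ((2 * d * z) ^ M * (Γ₂' * srwK d 1 M 0)) +
          (2 * d * z) ^ M * (Γ₂' ^ 2 * srwK d 2 M 0))) :=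
  sumLE_diagD_bubble_of_le (extraction_bound p hn M) hd hp hn hM hz hΓ

/-- **The Bubble cell with the printed constants `Γ₁, Γ₂`, unconditionally** (`(2d−1)p ≤ Γ₁`, `nobleF2 ≤ Γ₂`).
[cite: FitznerVanDerHofstad2016NoBLE, §5.3.1 and (5.13) (PTRF 169 (2017) pp. 1091, 1096–1097)]
[cite: FitznerVanDerHofstad2017, §4.2 (4.20)–(4.23) (arXiv:1506.07977v2 pp. 36–37)] -/
theorem sumLE_diagD_halfBubble_printed (hd : 5 ≤ d) (p : unitInterval) (hp : p < criticalProbI d) {n : ℕ}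
    (hn : 1 ≤ n) {M : ℕ} (hM : 2 * n ≤ M) {Γ₁ Γ₂ : ℝ} (hΓ1 : (2 * d - 1) * (p : ℝ) ≤ Γ₁)
    (hΓ2 : nobleF2 d p ≤ Γ₂) :
    SumLE (diagD d p n n)
      (1 / 2 * ((∑ L ∈ Finset.Ico (2 * n) M, ((L + 1 - 2 * n : ℕ) : ℝ) * ((trailWordsTo d L 0).card : ℝ) * (p : ℝ) ^ L) +
        ((M - 2 * n : ℕ) : ℝ) * ((2 * d / (2 * d - 1) * Γ₁) ^ M * ((2 * d - 2) / (2 * d - 1) * Γ₂ * srwK d 1 M 0)) +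
          (2 * d / (2 * d - 1) * Γ₁) ^ M * (((2 * d - 2) / (2 * d - 1) * Γ₂) ^ 2 * srwK d 2 M 0))) :=
  sumLE_diagD_bubble_printed (extraction_bound p hn M) hd hp hn hM hΓ1 hΓ2

/-- **[FvdH17] Lemma 4.2 (4.25), `Ξ^{(0)}`: `Σ_x Ξ^{(0)}_p(x) ≤ ½ · Bound[Bubble, 2]`** (SRW-integral form;
`d ≥ 5`, `p < p_c`, `2 ≤ M`), by (4.22) (`sumLE_nobleXiN_zero_of_diagD`) and the Bubble cell at `n = 1`.
[cite: FitznerVanDerHofstad2017, Lemma 4.2 (4.22), (4.25) (arXiv:1506.07977v2 p. 37; EJP 22 (2017) no. 43 p. 34)] -/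
theorem sumLE_nobleXiN_zero_halfBubble (hd : 5 ≤ d) (p : unitInterval) (hp : p < criticalProbI d) {M : ℕ}
    (hM : 2 ≤ M) :
    SumLE (nobleXiN d p 0)
      (1 / 2 * ((∑ L ∈ Finset.Ico 2 M, ((L + 1 - 2 : ℕ) : ℝ) * ((trailWordsTo d L 0).card : ℝ) * (p : ℝ) ^ L) +
        ((M - 2 : ℕ) : ℝ) * ((2 * d * (p : ℝ)) ^ M * (nobleSup2 d p * srwK d 1 M 0)) +
          (2 * d * (p : ℝ)) ^ M * (nobleSup2 d p ^ 2 * srwK d 2 M 0))) :=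
  sumLE_nobleXiN_zero_of_diagD p (sumLE_diagD_halfBubble hd p hp (n := 1) le_rfl (by omega))

/-- **[FvdH17] Lemma 4.2 (4.25), `Ξ^{R,(0)}`: `Σ_x Ξ^{R,(0)}_p(x) ≤ ½ · Bound[Bubble, 4]`** (SRW-integral form;
`d ≥ 5`, `p < p_c`, `4 ≤ M`), by `Ξ^{R,(0)} ≤ 𝒟_{2,2}` (`FvdH17_L42_d423a`) and the Bubble cell at `n = 2`
(the split object `percolationNobleSplit d p hd₂ hp` only needs `d ≥ 2`).
[cite: FitznerVanDerHofstad2017, Lemma 4.2 (4.23), (4.25) (arXiv:1506.07977v2 p. 37; EJP 22 (2017) no. 43 p. 34)] -/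
theorem sumLE_xiR_zero_halfBubble (hd₂ : 2 ≤ d) (hd : 5 ≤ d) (p : unitInterval) (hp : p < criticalProbI d)
    {M : ℕ} (hM : 4 ≤ M) :
    SumLE ((percolationNobleSplit d p hd₂ hp).xiR 0)
      (1 / 2 * ((∑ L ∈ Finset.Ico 4 M, ((L + 1 - 4 : ℕ) : ℝ) * ((trailWordsTo d L 0).card : ℝ) * (p : ℝ) ^ L) +
        ((M - 4 : ℕ) : ℝ) * ((2 * d * (p : ℝ)) ^ M * (nobleSup2 d p * srwK d 1 M 0)) +
          (2 * d * (p : ℝ)) ^ M * (nobleSup2 d p ^ 2 * srwK d 2 M 0))) :=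
  FvdH17_L42_d423a hd₂ p hp (sumLE_diagD_halfBubble hd p hp (n := 2) (by norm_num) hM)

end Literature.Probability.FitznerVanDerHofstad2017

end
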